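import Summits.Ventures.DiscreteObjects.Hadamard.ConferenceGraph333GroupOrbits
import Summits.Ventures.DiscreteObjects.Hadamard.ConferenceGraph333InvolutionBound149

/-!
# Klein four-groups in Aut(srg(333,166,82,83)): `#Fix τ + #Fix σ + #Fix τσ ≡ 7 (mod 8)` (kernel)

Framing: lottery ticket; floor = certified bounds/negative ranges.  Cell pub-namedobj (venture DiscreteObjects),
target (H) = `H(668)`, hadamard gen 32.  The first NON-CYCLIC instance of the group-orbit parity law
(`ConferenceGraph333GroupOrbits.autGroup_card_orbits_odd`: a group of automorphisms of order prime to `37` has an ODD number of orbits),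
spelled out at the element level for two distinct commuting involutions `τ, σ` (the four-group `{1, τ, σ, τσ}` has
`(333 + #Fix τ + #Fix σ + #Fix τσ)/4` orbits by Burnside):
* **`klein_four_fixed_sum_mod_eight`** — `#Fix τ + #Fix σ + #Fix (τσ) ≡ 7 (mod 8)`;
* **`klein_four_odd_number_five_mod_eight`** — since each of the three involutions fixes `≡ 1 (mod 4)` vertices (gen 28), an ODD number of them
  (one or all three) fix `≡ 5 (mod 8)` vertices; in particular they cannot all fix `≡ 1 (mod 8)` vertices.
(PAPER-SECTION-H-involutions-g31 §5 recorded a Hasse–Minkowski heuristic for four-groups; this is the representation-theoretic law instead: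
the `√333`-eigenspace is a `V₄`-module and the non-trivial part of the permutation module is twice it.)
WORDS: structure of a HYPOTHETICAL object; ours (PROVISIONAL).  No `sorry`, no new definitions.
-/

namespace Summit.Ventures.DiscreteObjects.Hadamard

open Finset MulAction

section kleinfour
variable {V : Type*} [Fintype V] [DecidableEq V]

/-- **Four-group law**: for distinct commuting involutive automorphisms `τ, σ`: `#Fix τ + #Fix σ + #Fix τσ ≡ 7 (mod 8)`. -/
theorem klein_four_fixed_sum_mod_eight (hV : Fintype.card V = 333) (A : Matrix V V ℤ)
    (h01 : ∀ x y, A x y = 0 ∨ A x y = 1) (hsymm : ∀ x y, A y x = A x y) (hdiag : ∀ x, A x x = 0)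
    (hk : ∀ x, ∑ y, A x y = 166) (hsrg : ∀ x y, ∑ z, A x z * A z y = 83 * (1 + (if x = y then 1 else 0)) - A x y)
    (τ σ : Equiv.Perm V) (hτ : τ ^ 2 = 1) (hσ : σ ^ 2 = 1) (hτ1 : τ ≠ 1) (hσ1 : σ ≠ 1) (hne : τ ≠ σ)
    (hc : τ * σ = σ * τ) (hAτ : ∀ x y, A (τ x) (τ y) = A x y) (hAσ : ∀ x y, A (σ x) (σ y) = A x y) :
    ((univ.filter fun x => τ x = x).card + (univ.filter fun x => σ x = x).card +
      (univ.filter fun x => (τ * σ) x = x).card) % 8 = 7 := by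
  classical
  -- products in the four-group
  have hττ : τ * τ = 1 := by rw [← pow_two]; exact hτ
  have hσσ : σ * σ = 1 := by rw [← pow_two]; exact hσ
  have hστ : σ * τ = τ * σ := hc.symm
  have p1 : τ * (τ * σ) = σ := by rw [← mul_assoc, hττ, one_mul]
  have p2 : σ * (τ * σ) = τ := by rw [hc, ← mul_assoc, hσσ, one_mul]
  have p3 : τ * σ * τ = σ := by rw [mul_assoc, hστ, p1]
  have p4 : τ * σ * σ = τ := by rw [mul_assoc, hσσ, mul_one]
  have p5 : τ * σ * (τ * σ) = 1 := by rw [← mul_assoc, p3, hσσ]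
  have hτinv : τ⁻¹ = τ := inv_eq_of_mul_eq_one_right hττ
  have hσinv : σ⁻¹ = σ := inv_eq_of_mul_eq_one_right hσσ
  -- distinctness
  have hτσ1 : τ * σ ≠ 1 := by
    intro h; apply hne
    calc τ = τ * σ * σ := p4.symm
      _ = σ := by rw [h, one_mul]
  have hτσ_τ : τ * σ ≠ τ := by
    intro h; apply hσ1
    have := congrArg (fun g => τ * g) h
    simp only [p1, hττ] at this
    exact this
  have hτσ_σ : τ * σ ≠ σ := by
    intro h; apply hτ1
    have := congrArg (fun g => g * σ) h
    simp only [p4, hσσ] at this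
    exact this
  -- the four-group as a subgroup
  let K : Subgroup (Equiv.Perm V) :=
    { carrier := {g | g = 1 ∨ g = τ ∨ g = σ ∨ g = τ * σ}
      mul_mem' := by
        rintro a b (rfl | rfl | rfl | rfl) (rfl | rfl | rfl | rfl) <;>
          simp [hττ, hσσ, hστ, p1, p2, p3, p4, p5]
      one_mem' := Or.inl rfl
      inv_mem' := by
        rintro a (rfl | rfl | rfl | rfl)
        · simp
        · simp [hτinv]
        · simp [hσinv]
        · simp [mul_inv_rev, hτinv, hσinv, hστ] }
  have hKmem : ∀ g : Equiv.Perm V, g ∈ K ↔ (g = 1 ∨ g = τ ∨ g = σ ∨ g = τ * σ) := fun g => Iff.rfl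
  have hK : ∀ g ∈ K, ∀ x y, A (g x) (g y) = A x y := by
    intro g hg x y
    rcases (hKmem g).mp hg with rfl | rfl | rfl | rfl
    · rfl
    · exact hAτ x y
    · exact hAσ x y
    · rw [Equiv.Perm.mul_apply, Equiv.Perm.mul_apply, hAτ, hAσ]
  letI : Fintype K := Fintype.ofFinite K
  -- |K| = 4
  set s : Finset (Equiv.Perm V) := {1, τ, σ, τ * σ} with hs
  have hsK : ∀ g, g ∈ s ↔ g ∈ K := by
    intro g; rw [hKmem, hs]; simp only [Finset.mem_insert, Finset.mem_singleton]
  have hscard : s.card = 4 := by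
    rw [hs, Finset.card_insert_of_notMem, Finset.card_insert_of_notMem, Finset.card_pair hτσ_σ.symm]
    · simp only [Finset.mem_insert, Finset.mem_singleton, not_or]; exact ⟨hne, hτσ_τ.symm⟩
    · simp only [Finset.mem_insert, Finset.mem_singleton, not_or]; exact ⟨hτ1.symm, hσ1.symm, hτσ1.symm⟩
  have hKcard : Fintype.card K = 4 := by rw [Fintype.card_of_subtype s hsK, hscard]
  have hKcard' : Nat.card K = 4 := by rw [Nat.card_eq_fintype_card, hKcard]
  have h37 : ¬ 37 ∣ Nat.card K := by rw [hKcard']; decide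
  -- odd number of orbits
  obtain ⟨r, hr⟩ := autGroup_card_orbits_odd hV A h01 hsymm hdiag hk hsrg K hK h37
  -- Burnside
  have hfixcard : ∀ g : K, Fintype.card (fixedBy V g) = (univ.filter fun x => (g : Equiv.Perm V) x = x).card := by
    intro g
    rw [← Set.toFinset_card]
    congr 1
    ext y
    rw [Set.mem_toFinset, Finset.mem_filter, MulAction.mem_fixedBy]
    simp [Subgroup.smul_def, Equiv.Perm.smul_def]
  have hB := MulAction.sum_card_fixedBy_eq_card_orbits_mul_card_group K V
  rw [Finset.sum_congr rfl fun g _ => hfixcard g, hKcard] at hB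
  have hNat : Nat.card (orbitRel.Quotient K V) = Fintype.card (Quotient (orbitRel K V)) :=
    (Nat.card_eq_fintype_card).trans (Fintype.card_congr' rfl)
  rw [← hNat, hr] at hB
  -- the sum over K as a sum over s
  have hsum : ∑ g : K, (univ.filter fun x => (g : Equiv.Perm V) x = x).card =
      ∑ g ∈ s, (univ.filter fun x => g x = x).card := (Finset.sum_subtype s hsK (fun g => (univ.filter fun x => g x = x).card)).symm
  rw [hsum, hs, Finset.sum_insert, Finset.sum_insert, Finset.sum_pair hτσ_σ.symm] at hB
  · have h1 : (univ.filter fun x : V => (1 : Equiv.Perm V) x = x).card = 333 := by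
      simp [hV]
    rw [h1] at hB
    omega
  · simp only [Finset.mem_insert, Finset.mem_singleton, not_or]; exact ⟨hne, hτσ_τ.symm⟩
  · simp only [Finset.mem_insert, Finset.mem_singleton, not_or]; exact ⟨hτ1.symm, hσ1.symm, hτσ1.symm⟩

/-- **An odd number of the three involutions of a four-group fix `≡ 5 (mod 8)` vertices** (one or all three). -/
theorem klein_four_odd_number_five_mod_eight (hV : Fintype.card V = 333) (A : Matrix V V ℤ)
    (h01 : ∀ x y, A x y = 0 ∨ A x y = 1) (hsymm : ∀ x y, A y x = A x y) (hdiag : ∀ x, A x x = 0)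
    (hk : ∀ x, ∑ y, A x y = 166) (hsrg : ∀ x y, ∑ z, A x z * A z y = 83 * (1 + (if x = y then 1 else 0)) - A x y)
    (τ σ : Equiv.Perm V) (hτ : τ ^ 2 = 1) (hσ : σ ^ 2 = 1) (hτ1 : τ ≠ 1) (hσ1 : σ ≠ 1) (hne : τ ≠ σ)
    (hc : τ * σ = σ * τ) (hAτ : ∀ x y, A (τ x) (τ y) = A x y) (hAσ : ∀ x y, A (σ x) (σ y) = A x y) :
    ((univ.filter fun x => τ x = x).card % 8 = 5 ∧ (univ.filter fun x => σ x = x).card % 8 = 1 ∧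
        (univ.filter fun x => (τ * σ) x = x).card % 8 = 1) ∨
    ((univ.filter fun x => τ x = x).card % 8 = 1 ∧ (univ.filter fun x => σ x = x).card % 8 = 5 ∧
        (univ.filter fun x => (τ * σ) x = x).card % 8 = 1) ∨
    ((univ.filter fun x => τ x = x).card % 8 = 1 ∧ (univ.filter fun x => σ x = x).card % 8 = 1 ∧
        (univ.filter fun x => (τ * σ) x = x).card % 8 = 5) ∨
    ((univ.filter fun x => τ x = x).card % 8 = 5 ∧ (univ.filter fun x => σ x = x).card % 8 = 5 ∧
        (univ.filter fun x => (τ * σ) x = x).card % 8 = 5) := by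
  have hsum := klein_four_fixed_sum_mod_eight hV A h01 hsymm hdiag hk hsrg τ σ hτ hσ hτ1 hσ1 hne hc hAτ hAσ
  have hinv : ∀ γ : Equiv.Perm V, γ ^ 2 = 1 → ∀ x, γ (γ x) = x := fun γ h x => by
    have := congrArg (fun g : Equiv.Perm V => g x) h
    simpa [pow_two] using this
  have hττ : τ * τ = 1 := by rw [← pow_two]; exact hτ
  have hσσ : σ * σ = 1 := by rw [← pow_two]; exact hσ
  have hτσ2 : (τ * σ) ^ 2 = 1 := by
    rw [pow_two, show τ * σ * (τ * σ) = τ * (σ * τ) * σ by simp only [mul_assoc], ← hc, ← mul_assoc, hττ, one_mul, hσσ]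
  have hτσ1 : τ * σ ≠ 1 := by
    intro h; apply hne
    calc τ = τ * (σ * σ) := by rw [hσσ, mul_one]
      _ = τ * σ * σ := by rw [mul_assoc]
      _ = σ := by rw [h, one_mul]
  have m1 := (involution_window_149 hV A h01 hsymm hdiag hk hsrg τ (hinv τ hτ) hτ1 hAτ).1
  have m2 := (involution_window_149 hV A h01 hsymm hdiag hk hsrg σ (hinv σ hσ) hσ1 hAσ).1
  have m3 := (involution_window_149 hV A h01 hsymm hdiag hk hsrg (τ * σ) (hinv _ hτσ2) hτσ1
    (fun x y => by rw [Equiv.Perm.mul_apply, Equiv.Perm.mul_apply, hAτ, hAσ])).1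
  omega

end kleinfour

end Summit.Ventures.DiscreteObjects.Hadamard
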